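import Mathlib
import Literature.Analysis.FluidPDE.VectorCalculus
import Summits.NavierStokesRegularity.NavierStokesRegularity.Theorems.ThreadingFluxErtelTowerVorticityFrozen
import HarnessLib

/-!
# Crux `PoloidalLiouville` (stmt-NavierStokesRegularity-1222, W1), crux idea «radial-jerk-tower» (ns-idea-15 g7):
# THE EULER TOWER — Ertel commutation and the four inviscid Props of the sketch BY NAME

Support file (`--supports stmt-NavierStokesRegularity-1222`, helper).  Experiment cell `ns-wall-extremal`, width hand
ns-wall-eng-5 g6, director KEY-NS #186 («V21 radial-jerk-tower sizes go to eng-5 g6»); critic of record ns-wall-crit-1 g4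
(V21 PASS-WITH-PRICE).  0 kit.

The sketch `Cruxes/PoloidalLiouville/ErtelTowerSketch.lean` (v1.1) Part B types four INVISCID statements about a smooth
incompressible Euler solution `(v, p)` on an open `I × U` (`∂ₜv + Dv[v] + ∇p = 0`, `div v = 0`), unthreaded about `x₀`
(`⟪ω, x − x₀⟫ ≡ 0`, `ω = curl v`); their Theorems-side twins (bodies verbatim) are in `ThreadingFluxErtelTowerDefs`.  This file
proves all four, by name, from `vorticity_frozen` (`ThreadingFluxErtelTowerVorticityFrozen`) and the frozen-field machinery of
`ThreadingFluxErtelTowerKinematicRigidity`: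

* `ertel_commutation` — ERTEL'S COMMUTATION FORMULA WITH SOURCE, for ANY jointly smooth drift `u`, field `B` and level
  function `θ`: `Dₜ⟪B,∇θ⟫ = ⟪B, ∇(Dₜθ)⟫ + ⟪S, ∇θ⟫` with `Dₜ = ∂ₜ + u·∇` and `S = ∂ₜB + DB[u] − Du[B]` the frozen-field
  residual (second-order terms by the symmetry of `D²(uncurry θ)`); `ertel_commutation_frozen` — the case `S = 0`;
* `radialJerk_two_eq` — on an Euler solution level 2 of the radial-jerk tower is the radial Bernoulli function
  `θ₂ = ‖v‖² − ⟪x − x₀, ∇p⟫` on `I × U`;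
* ★ `ertelCommutation : ErtelCommutation`, ★ `inviscidRadialJerkTower : InviscidRadialJerkTower`,
  ★ `eulerRadialBernoulli : EulerRadialBernoulli`, ★ `radialJerkRankTwo : RadialJerkRankTwo` — the sketch Props by name;
* `euler_curl_eq_zero_of_rankTwo_dense` — the composition `inviscidKinematicRigidity ∘ vorticity_frozen`: an unthreaded Euler
  flow whose rank-two set is dense at every time is irrotational (untyped corollary; no sketch Prop).

BOOKING (critic's words, V21): these are the classical inviscid facts (Ertel's commutation formula; Kelvin — vortex lines are
material, so every material derivative of a vortex-line integral is one) typed for the lineage's radial-jerk tower; they are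
statements about EULER in a region, carry NO W1 movement by themselves (the viscous level-two law `ViscousLevelTwoLaw` and the
strain-shadow classification remain the load-bearing OPEN items of the line), and refute nothing.  `PoloidalLiouville` (1222)
and (27585) are OPEN; NS regularity is NOT proved.
-/

-- the summit and its single problem share the name (D-0017 nested layout)
set_option linter.dupNamespace false

noncomputable section

namespace Summit.NavierStokesRegularity.NavierStokesRegularity.Theorems.PoloidalLiouville.ErtelTower

open Set Function Filter Topology Metric
open scoped Topology RealInnerProductSpace InnerProductSpace
open Literature.Analysis.FluidPDE
open Summit.NavierStokesRegularity.NavierStokesRegularity.Theorems.PoloidalLiouville.HorizonTower (E3)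

/-! ### The general Ertel commutation for a frozen field -/

section Commutation

variable {u B : ℝ → E3 → E3} {θ : ℝ → E3 → ℝ} {I : Set ℝ} {U : Set E3}

/-- **ERTEL COMMUTATION WITH SOURCE (general drift, general field, general level function).**  Let `u, B, θ` be jointly
smooth on the open `I × U`, `Dₜ = ∂ₜ + u·∇` the material derivative and `S = ∂ₜB + DB[u] − Du[B]` the frozen-field residual of
`B` (for the vorticity of a Navier–Stokes flow `S = Δω`, of an Euler flow `S = 0`).  Then on `I × U`
`Dₜ⟪B, ∇θ⟫ = ⟪B, ∇(Dₜθ)⟫ + ⟪S, ∇θ⟫`.  (With `F = uncurry θ`, `G(p) = DF(p)[(0,B p)] = ⟪B,∇θ⟫`: `DG[(1,u)] =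
DF[(0, DB[(1,u)])] + D²F[(1,u),(0,B)]` and `D_x(Dₜθ)[B] = DF[(0, Du[B])] + D²F[(0,B),(1,u)]`; the second-order terms agree by
the symmetry of `D²F`, the first-order ones differ by `DF[(0,S)] = ⟪S,∇θ⟫`.) -/
theorem ertel_commutation (hI : IsOpen I) (hU : IsOpen U)
    (hu : ContDiffOn ℝ (⊤ : ℕ∞) (Function.uncurry u) (I ×ˢ U))
    (hB : ContDiffOn ℝ (⊤ : ℕ∞) (Function.uncurry B) (I ×ˢ U))
    (hθ : ContDiffOn ℝ (⊤ : ℕ∞) (Function.uncurry θ) (I ×ˢ U)) :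
    ∀ t ∈ I, ∀ x ∈ U,
      deriv (fun s => inner ℝ (B s x) (gradient (θ s) x)) t
          + inner ℝ (u t x) (gradient (fun z => inner ℝ (B t z) (gradient (θ t) z)) x)
        = inner ℝ (B t x) (gradient (fun z => deriv (fun s => θ s z) t + inner ℝ (u t z) (gradient (θ t) z)) x)
          + inner ℝ (deriv (fun s => B s x) t + fderiv ℝ (B t) x (u t x) - fderiv ℝ (u t) x (B t x))
              (gradient (θ t) x) := by
  intro t ht x hx
  set F := Function.uncurry θ with hFdef
  have hopen : IsOpen (I ×ˢ U) := hI.prod hU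
  have hmem : (t, x) ∈ I ×ˢ U := ⟨ht, hx⟩
  have hFat : ContDiffAt ℝ (⊤ : ℕ∞) F (t, x) := contDiffAt_of_contDiffOn_prod hθ hI hU ht hx
  have hBat : ContDiffAt ℝ (⊤ : ℕ∞) (Function.uncurry B) (t, x) := contDiffAt_of_contDiffOn_prod hB hI hU ht hx
  have huat : ContDiffAt ℝ (⊤ : ℕ∞) (Function.uncurry u) (t, x) := contDiffAt_of_contDiffOn_prod hu hI hU ht hx
  have hDF : ContDiffAt ℝ (⊤ : ℕ∞) (fderiv ℝ F) (t, x) :=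
    hFat.fderiv_right (m := (⊤ : ℕ∞)) (by exact_mod_cast le_top)
  have hDFd : DifferentiableAt ℝ (fderiv ℝ F) (t, x) := hDF.differentiableAt (by simp)
  have hFd : DifferentiableAt ℝ F (t, x) := hFat.differentiableAt (by simp)
  have hBd : DifferentiableAt ℝ (Function.uncurry B) (t, x) := hBat.differentiableAt (by simp)
  have hud : DifferentiableAt ℝ (Function.uncurry u) (t, x) := huat.differentiableAt (by simp)
  -- (0) `DF(t,x)[(0,w)] = ⟪w, ∇θ(t)(x)⟫`
  have hslice : ∀ w : E3, fderiv ℝ F (t, x) ((0 : ℝ), w) = inner ℝ w (gradient (θ t) x) := fun w => by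
    rw [← inner_gradient_slice_space hFd w, real_inner_comm]; rfl
  -- (1) `G(p) = DF(p)[(0, B p)] = ⟪B, ∇θ⟫` on `I × U`
  have hGeq : ∀ q ∈ I ×ˢ U, inner ℝ (B q.1 q.2) (gradient (θ q.1) q.2) = fderiv ℝ F q ((0 : ℝ), Function.uncurry B q) := by
    rintro ⟨s, z⟩ hq
    have hd : DifferentiableAt ℝ F (s, z) :=
      (contDiffAt_of_contDiffOn_prod hθ hI hU hq.1 hq.2).differentiableAt (by simp)
    rw [← inner_gradient_slice_space hd, real_inner_comm]
    rfl
  have hw : HasFDerivAt (fun q : ℝ × E3 => ((0 : ℝ), Function.uncurry B q))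
      ((0 : ℝ × E3 →L[ℝ] ℝ).prod (fderiv ℝ (Function.uncurry B) (t, x))) (t, x) :=
    (hasFDerivAt_const (0 : ℝ) (t, x)).prodMk hBd.hasFDerivAt
  have hG := hDFd.hasFDerivAt.clm_apply hw
  -- the left side is the material derivative of `G` at `(t,x)`
  have e1 : deriv (fun s => inner ℝ (B s x) (gradient (θ s) x)) t
        + inner ℝ (u t x) (gradient (fun z => inner ℝ (B t z) (gradient (θ t) z)) x)
      = fderiv ℝ F (t, x) ((0 : ℝ), fderiv ℝ (Function.uncurry B) (t, x) ((1 : ℝ), u t x))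
        + (fderiv ℝ (fderiv ℝ F) (t, x) ((1 : ℝ), u t x)) ((0 : ℝ), B t x) := by
    have hev_t : (fun s => inner ℝ (B s x) (gradient (θ s) x)) =ᶠ[𝓝 t]
        fun s => (fun q : ℝ × E3 => fderiv ℝ F q ((0 : ℝ), Function.uncurry B q)) (s, x) := by
      filter_upwards [hI.mem_nhds ht] with s hs using hGeq (s, x) ⟨hs, hx⟩
    have hev_x : (fun z => inner ℝ (B t z) (gradient (θ t) z)) =ᶠ[𝓝 x]
        fun z => (fun q : ℝ × E3 => fderiv ℝ F q ((0 : ℝ), Function.uncurry B q)) (t, z) := by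
      filter_upwards [hU.mem_nhds hx] with z hz using hGeq (t, z) ⟨ht, hz⟩
    rw [hev_t.deriv_eq, hev_x.gradient_eq, materialDeriv_eq hG.differentiableAt (u t x), hG.fderiv]
    simp [ContinuousLinearMap.comp_apply, ContinuousLinearMap.flip_apply]
  -- (2) `D(uncurry B)(t,x)[(1,u)] = ∂ₜB + D(B t)[u]`
  have hBslice_t : HasDerivAt (fun s => B s x) (fderiv ℝ (Function.uncurry B) (t, x) (1, 0)) t := by
    have h1 : HasDerivAt (fun s : ℝ => (s, x)) (1, 0) t := (hasDerivAt_id t).prodMk (hasDerivAt_const t x)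
    exact hBd.hasFDerivAt.comp_hasDerivAt t h1
  have hBslice_x : HasFDerivAt (B t) ((fderiv ℝ (Function.uncurry B) (t, x)).comp (ContinuousLinearMap.inr ℝ ℝ E3)) x := by
    have h1 : HasFDerivAt (fun w : E3 => (t, w)) (ContinuousLinearMap.inr ℝ ℝ E3) x :=
      (hasFDerivAt_const t x).prodMk (hasFDerivAt_id x)
    exact hBd.hasFDerivAt.comp x h1
  have hsum : fderiv ℝ (Function.uncurry B) (t, x) ((1 : ℝ), u t x)
      = deriv (fun s => B s x) t + fderiv ℝ (B t) x (u t x) := by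
    rw [hBslice_t.deriv, hBslice_x.fderiv]
    have hsplit : ((1 : ℝ), u t x) = ((1 : ℝ), (0 : E3)) + ((0 : ℝ), u t x) := by simp
    rw [hsplit, map_add]
    rfl
  -- (3) the successor's x-derivative in the direction `B`
  have hsucc_ev : (fun z => deriv (fun s => θ s z) t + inner ℝ (u t z) (gradient (θ t) z))
      =ᶠ[𝓝 x] fun z => fderiv ℝ F (t, z) ((1 : ℝ), u t z) := by
    filter_upwards [hU.mem_nhds hx] with z hz using succ_eq_fderiv hθ hI hU ht hz
  have huslice : HasFDerivAt (u t) ((fderiv ℝ (Function.uncurry u) (t, x)).comp (ContinuousLinearMap.inr ℝ ℝ E3)) x := by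
    have h1 : HasFDerivAt (fun w : E3 => (t, w)) (ContinuousLinearMap.inr ℝ ℝ E3) x :=
      (hasFDerivAt_const t x).prodMk (hasFDerivAt_id x)
    exact hud.hasFDerivAt.comp x h1
  have hc : HasFDerivAt (fun z : E3 => fderiv ℝ F (t, z)) ((fderiv ℝ (fderiv ℝ F) (t, x)).comp (ContinuousLinearMap.inr ℝ ℝ E3)) x := by
    have h1 : HasFDerivAt (fun w : E3 => (t, w)) (ContinuousLinearMap.inr ℝ ℝ E3) x :=
      (hasFDerivAt_const t x).prodMk (hasFDerivAt_id x)
    exact hDFd.hasFDerivAt.comp x h1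
  have hw2 : HasFDerivAt (fun z : E3 => ((1 : ℝ), u t z)) ((0 : E3 →L[ℝ] ℝ).prod (fderiv ℝ (u t) x)) x :=
    (hasFDerivAt_const (1 : ℝ) x).prodMk huslice.differentiableAt.hasFDerivAt
  have hH := hc.clm_apply hw2
  have e2 : inner ℝ (B t x) (gradient (fun z => deriv (fun s => θ s z) t + inner ℝ (u t z) (gradient (θ t) z)) x)
      = fderiv ℝ F (t, x) ((0 : ℝ), fderiv ℝ (u t) x (B t x))
        + (fderiv ℝ (fderiv ℝ F) (t, x) ((0 : ℝ), B t x)) ((1 : ℝ), u t x) := by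
    rw [real_inner_comm, _root_.inner_gradient_left, hsucc_ev.fderiv_eq, hH.fderiv]
    simp [ContinuousLinearMap.comp_apply, ContinuousLinearMap.flip_apply]
  -- (4) symmetry of the second derivative of `F`
  have hsymm : (fderiv ℝ (fderiv ℝ F) (t, x) ((0 : ℝ), B t x)) ((1 : ℝ), u t x)
      = (fderiv ℝ (fderiv ℝ F) (t, x) ((1 : ℝ), u t x)) ((0 : ℝ), B t x) :=
    (hFat.isSymmSndFDerivAt (by
      rw [minSmoothness_of_isRCLikeNormedField]; exact WithTop.coe_le_coe.mpr le_top)) _ _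
  -- (5) assemble: everything is a real number
  rw [e1, e2, hsymm, hslice, hslice, hsum, inner_sub_left]
  ring

/-- **ERTEL COMMUTATION (frozen field)**: if moreover `B` is frozen into `u` (`∂ₜB + DB[u] − Du[B] = 0` on `I × U`), then
`Dₜ⟪B, ∇θ⟫ = ⟪B, ∇(Dₜθ)⟫` on `I × U`. -/
theorem ertel_commutation_frozen (hI : IsOpen I) (hU : IsOpen U)
    (hu : ContDiffOn ℝ (⊤ : ℕ∞) (Function.uncurry u) (I ×ˢ U))
    (hB : ContDiffOn ℝ (⊤ : ℕ∞) (Function.uncurry B) (I ×ˢ U))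
    (hθ : ContDiffOn ℝ (⊤ : ℕ∞) (Function.uncurry θ) (I ×ˢ U))
    (hfrozen : ∀ t ∈ I, ∀ x ∈ U,
      deriv (fun s => B s x) t + fderiv ℝ (B t) x (u t x) - fderiv ℝ (u t) x (B t x) = 0) :
    ∀ t ∈ I, ∀ x ∈ U,
      deriv (fun s => inner ℝ (B s x) (gradient (θ s) x)) t
          + inner ℝ (u t x) (gradient (fun z => inner ℝ (B t z) (gradient (θ t) z)) x)
        = inner ℝ (B t x) (gradient (fun z => deriv (fun s => θ s z) t + inner ℝ (u t z) (gradient (θ t) z)) x) := by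
  intro t ht x hx
  rw [ertel_commutation hI hU hu hB hθ t ht x hx, hfrozen t ht x hx, inner_zero_left, add_zero]

end Commutation

/-! ### The Euler tower: the four inviscid Props of the sketch, by name -/

section EulerTower

variable {v : ℝ → E3 → E3} {p : ℝ → E3 → ℝ} {x₀ : E3} {I : Set ℝ} {U : Set E3}

/-- **Level 2 of the tower on an Euler solution is the radial Bernoulli function**: for `t ∈ I`, `x ∈ U`,
`θ₂(t,x) = ‖v‖² − ⟪x − x₀, ∇p⟫` (`θ₁ = ⟪v, x − x₀⟫`, `Dₜθ₁ = ⟪Dₜv, x − x₀⟫ + ⟪v, Dv·(x−x₀) + v⟫... = ‖v‖² + ⟪∂ₜv + Dv[v], x − x₀⟫`). -/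
theorem radialJerk_two_eq (hI : IsOpen I) (hU : IsOpen U)
    (hv : ContDiffOn ℝ (⊤ : ℕ∞) (Function.uncurry v) (I ×ˢ U))
    (heuler : ∀ t ∈ I, ∀ x ∈ U, deriv (fun s => v s x) t + fderiv ℝ (v t) x (v t x) + gradient (p t) x = 0)
    {t : ℝ} {x : E3} (ht : t ∈ I) (hx : x ∈ U) :
    radialJerk v x₀ 2 t x = ‖v t x‖ ^ 2 - inner ℝ (x - x₀) (gradient (p t) x) := by
  have hVd : DifferentiableAt ℝ (Function.uncurry v) (t, x) :=
    (contDiffAt_of_contDiffOn_prod hv hI hU ht hx).differentiableAt (by simp)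
  have h1 : radialJerk v x₀ 1 = fun s z => inner ℝ (v s z) (z - x₀) := by
    funext s z; exact radialJerk_one v x₀ s z
  rw [show radialJerk v x₀ 2 t x = deriv (fun s => radialJerk v x₀ 1 s x) t
      + inner ℝ (v t x) (gradient (radialJerk v x₀ 1 t) x) from rfl, h1]
  dsimp only
  -- time derivative of `⟪v s x, x − x₀⟫`
  have hvt : HasDerivAt (fun s => v s x) (deriv (fun s => v s x) t) t := by
    have h1 : HasDerivAt (fun s : ℝ => (s, x)) (1, 0) t := (hasDerivAt_id t).prodMk (hasDerivAt_const t x)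
    exact (hVd.hasFDerivAt.comp_hasDerivAt t h1).differentiableAt.hasDerivAt
  have hdt : deriv (fun s => inner ℝ (v s x) (x - x₀)) t = inner ℝ (deriv (fun s => v s x) t) (x - x₀) := by
    have h := hvt.inner ℝ (hasDerivAt_const t (x - x₀))
    rw [h.deriv]; simp
  -- space gradient of `⟪v t z, z − x₀⟫` paired with `v t x`
  have hvx : HasFDerivAt (v t) (fderiv ℝ (v t) x) x := by
    have h1 : HasFDerivAt (fun w : E3 => (t, w)) (ContinuousLinearMap.inr ℝ ℝ E3) x :=
      (hasFDerivAt_const t x).prodMk (hasFDerivAt_id x)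
    exact (hVd.hasFDerivAt.comp x h1).differentiableAt.hasFDerivAt
  have hdx : inner ℝ (v t x) (gradient (fun z => inner ℝ (v t z) (z - x₀)) x)
      = inner ℝ (fderiv ℝ (v t) x (v t x)) (x - x₀) + ‖v t x‖ ^ 2 := by
    have h : HasFDerivAt (fun z : E3 => inner ℝ (v t z) (z - x₀))
        ((fderivInnerCLM ℝ (v t x, x - x₀)).comp ((fderiv ℝ (v t) x).prod (ContinuousLinearMap.id ℝ E3))) x :=
      hvx.inner ℝ ((hasFDerivAt_id x).sub_const x₀)
    rw [real_inner_comm, _root_.inner_gradient_left, h.fderiv]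
    simp [fderivInnerCLM_apply]
    ring
  rw [hdt, hdx]
  have he : deriv (fun s => v s x) t + fderiv ℝ (v t) x (v t x) = -gradient (p t) x :=
    eq_neg_of_add_eq_zero_left (heuler t ht x hx)
  have : inner ℝ (deriv (fun s => v s x) t) (x - x₀) + inner ℝ (fderiv ℝ (v t) x (v t x)) (x - x₀)
      = -inner ℝ (x - x₀) (gradient (p t) x) := by
    rw [← inner_add_left, he, inner_neg_left, real_inner_comm]
  linarith

/-- ★ **`ErtelCommutation` (ErtelTowerSketch Part B) is a theorem**: on a smooth incompressible Euler solution on the open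
`I × U` the vorticity is frozen (`vorticity_frozen`), so `ertel_commutation_frozen` applies with `B = curl v`. -/
theorem ertelCommutation : ErtelCommutation := by
  intro v p θ I U hI hU hv hp hθ heuler hdiv t ht x hx
  exact ertel_commutation_frozen (B := fun s z => curl (v s) z) hI hU hv (contDiffOn_curl_uncurry hv hI hU) hθ
    (vorticity_frozen hI hU hv hp heuler hdiv) t ht x hx

/-- ★ **`InviscidRadialJerkTower` is a theorem**: every radial jerk `θ_k` of a smooth unthreaded Euler solution is a
vortex-line integral, `⟪ω, ∇θ_k⟫ ≡ 0` on `I × U` (`inner_gradient_radialJerk_eq_zero` with `B = ω = curl v`, frozen by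
`vorticity_frozen`). -/
theorem inviscidRadialJerkTower : InviscidRadialJerkTower := by
  intro v p x₀ I U hI hU hv hp heuler hdiv hunthr k t ht x hx
  exact inner_gradient_radialJerk_eq_zero (B := fun s z => curl (v s) z) hI hU hv (contDiffOn_curl_uncurry hv hI hU)
    (vorticity_frozen hI hU hv hp heuler hdiv) hunthr k t ht x hx

/-- ★ **`EulerRadialBernoulli` is a theorem**: the radial Bernoulli function `‖v‖² − ⟪x − x₀, ∇p⟫` is a vortex-line integral
of every smooth unthreaded Euler solution (level `k = 2` of `inviscidRadialJerkTower`, via `radialJerk_two_eq` on the open `U`). -/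
theorem eulerRadialBernoulli : EulerRadialBernoulli := by
  intro v p x₀ I U hI hU hv hp heuler hdiv hunthr t ht x hx
  have hev : (fun z => ‖v t z‖ ^ 2 - inner ℝ (z - x₀) (gradient (p t) z)) =ᶠ[𝓝 x] radialJerk v x₀ 2 t := by
    filter_upwards [hU.mem_nhds hx] with z hz using (radialJerk_two_eq hI hU hv heuler ht hz).symm
  rw [hev.gradient_eq]
  exact inviscidRadialJerkTower v p x₀ I U hI hU hv hp heuler hdiv hunthr 2 t ht x hx

/-- ★ **`RadialJerkRankTwo` is a theorem**: where `ω ≠ 0`, the three vortex-line integrals `½‖x−x₀‖², θ₁, θ₂` have linearly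
dependent gradients, `⟪x − x₀, ∇θ₁ × ∇θ₂⟫ = 0` (contrapositive of Cramer `eq_zero_of_inner_frame`: `ω` is orthogonal to
`x − x₀`, `∇θ₁`, `∇θ₂`). -/
theorem radialJerkRankTwo : RadialJerkRankTwo := by
  intro v p x₀ I U hI hU hv hp heuler hdiv hunthr t ht x hx hne
  by_contra hdet
  exact hne (eq_zero_of_inner_frame (hunthr t ht x hx)
    (inviscidRadialJerkTower v p x₀ I U hI hU hv hp heuler hdiv hunthr 1 t ht x hx)
    (inviscidRadialJerkTower v p x₀ I U hI hU hv hp heuler hdiv hunthr 2 t ht x hx) hdet)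

/-- **Inviscid rigidity for Euler** (the composition `inviscidKinematicRigidity ∘ vorticity_frozen`): a smooth unthreaded
Euler solution on the open `I × U` whose RANK-TWO set `{x ∈ U | ⟪x − x₀, ∇θ₁ × ∇θ₂⟫ ≠ 0}` is dense in `U` at every time of `I`
is IRROTATIONAL on `I × U`.  Equivalently (with `radialJerkRankTwo`): for a rotational unthreaded Euler flow the radial-jerk
frame degenerates on a nonempty open subset of `U` at some time. -/
theorem euler_curl_eq_zero_of_rankTwo_dense (hI : IsOpen I) (hU : IsOpen U)
    (hv : ContDiffOn ℝ (⊤ : ℕ∞) (Function.uncurry v) (I ×ˢ U))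
    (hp : ContDiffOn ℝ (⊤ : ℕ∞) (Function.uncurry p) (I ×ˢ U))
    (heuler : ∀ t ∈ I, ∀ x ∈ U, deriv (fun s => v s x) t + fderiv ℝ (v t) x (v t x) + gradient (p t) x = 0)
    (hdiv : ∀ t ∈ I, ∀ x ∈ U, Literature.Analysis.FluidPDE.VectorCalculus.divergence (v t) x = 0)
    (hunthr : ∀ t ∈ I, ∀ x ∈ U, inner ℝ (curl (v t) x) (x - x₀) = 0)
    (hdense : ∀ t ∈ I, U ⊆ closure {x | x ∈ U ∧
        inner ℝ (x - x₀) (cross (gradient (radialJerk v x₀ 1 t) x) (gradient (radialJerk v x₀ 2 t) x)) ≠ 0}) :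
    ∀ t ∈ I, ∀ x ∈ U, curl (v t) x = 0 :=
  inviscidKinematicRigidity v (fun s z => curl (v s) z) x₀ I U hI hU hv (contDiffOn_curl_uncurry hv hI hU)
    (vorticity_frozen hI hU hv hp heuler hdiv) hunthr hdense

end EulerTower

end Summit.NavierStokesRegularity.NavierStokesRegularity.Theorems.PoloidalLiouville.ErtelTower
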